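import Literature.Probability.LatticeModels.LoopO1
import Literature.Probability.LatticeModels.IsingThermodynamics
import Mathlib.Analysis.SpecialFunctions.Trigonometric.DerivHyp
import HarnessLib

/-!
# Route `FKParityRobustness`, crux `ParityRobustMerging` (stmt-CriticalPhenomena-11253):
# vocabulary of the line `plaquette-xor-surgery`

Route-posited objects (D-0016 `<Route>Defs` file) shared by the registered stubs of the skeleton
`Cruxes/ParityRobustMerging/Lines/plaquette-xor-surgery.lean` and by the crux file that composes
them.  Everything here is a plain finite-graph / finite-sum definition over the tree's `tJoins`
(`Literature/Probability/LatticeModels/LoopO1.lean`); nothing is asserted.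

* `JoinsAll a F` — all four marked vertices `a i` lie in one component of the spanning subgraph
  `(V, F)` (verbatim the predicate of the crux's numerator `u_a`);
* `IsPlaquette G P`, `plaquettes G` — edge sets of 4-cycles of `G` (on a box of `ℤ³`: the unit
  squares inside the box);
* `nearTouch G a F` — plaquettes edge-disjoint from `F` whose addition joins all four sources
  (the near-touch → touch surgery `F ↦ F ⊔ P` of the idea card);
* `pivotals G a F` — full plaquettes `P ⊆ F` whose removal un-joins the sources;
* `zMass G t a P = ∑ {t^{|F|} : F ∈ 𝒯_A(G), P F}` — the sourced loop-O(1) mass of the `T`-joins of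
  `A = {a i}` satisfying `P` (for `P = ⊤` this is `loopO1PartitionFunction G t A`,
  see `zMass_true_eq_loopO1PartitionFunction`);
* `ntMass`, `pivMass` — the near-touch mass `∑_{F ∈ H} t^{|F|+4}·#nearTouch(F)` and the pivotal
  mass `∑_{F ∈ C} t^{|F|}·#pivotals(F)` of the plaquette-XOR transport identity;
* the box setting of the crux: `tetra` (the unit tetrahedron of the route, verbatim the crux's
  `let tetra`), `boxGraph N = (zdGraph 3).comap Subtype.val` on `↥(box 3 N)` (verbatim the crux's
  `let G`), `tc = tanh β_c(3)`;
* small API: `tetra_inj`, `tetra_injective`, `tanh_criticalBeta_nonneg`, `zMass_nonneg`,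
  `zMass_split` (`Z(A) = Z(A;C) + Z(A;H)`; its closed form is the registered bookkeeping stub
  `stub_massSplit` of the skeleton, through which this vocabulary file lands as a `--supports` file).

References: U. T. Hansen, J. Jiang, F. R. Klausen, arXiv:2506.10765 §2 (sourced loop O(1));
G. Grimmett, S. Janson, *Random even graphs*, arXiv:0709.3039; the line card
`Cruxes/ParityRobustMerging/Lines/plaquette-xor-surgery.md`.
-/

noncomputable section

open Finset
open Literature.Probability.LatticeModels

namespace Summit.CriticalPhenomena.Ising3DConformalLimit.Cruxes.ParityRobustMerging.PlaquetteXorSurgery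

/-! ### The tetrahedral sources of the crux -/

/-- The unit tetrahedron `{(−1,−1,−1), (1,1,−1), (1,−1,1), (−1,1,1)}` of the route (verbatim the
crux's `let tetra`); the sources of the crux are `a = l • tetra`, `l ≥ 1`. -/
def tetra : Fin 4 → Site 3 := ![![-1, -1, -1], ![1, 1, -1], ![1, -1, 1], ![-1, 1, 1]]

/-- The four vertices of the unit tetrahedron are distinct. -/
theorem tetra_inj : Function.Injective tetra := by
  unfold tetra
  decide

/-- The sources `a = l • tetra` (`l ≥ 1`) of the crux are four distinct vertices of the box. -/
theorem tetra_injective {l : ℕ} (hl : 1 ≤ l) {N : ℕ} (a : Fin 4 → ↥(box 3 N))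
    (ha : ∀ i, ((a i : Site 3)) = (l : ℤ) • tetra i) : Function.Injective a := by
  intro i j hij
  have h : (l : ℤ) • tetra i = (l : ℤ) • tetra j := by rw [← ha i, ← ha j, hij]
  have hl0 : (l : ℤ) ≠ 0 := by exact_mod_cast (show l ≠ 0 by omega)
  exact tetra_inj (smul_right_injective (Site 3) hl0 h)

/-- `tanh β_c(3) ≥ 0` (from `criticalBeta_nonneg`). -/
theorem tanh_criticalBeta_nonneg : 0 ≤ Real.tanh (criticalBeta 3) := by
  rw [Real.tanh_eq_sinh_div_cosh]
  exact div_nonneg (Real.sinh_nonneg_iff.2 (criticalBeta_nonneg 3)) (Real.cosh_pos _).le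

open scoped Classical

/-! ### Vocabulary of the line (general finite graph) -/

section General

variable {V : Type*} [Fintype V] [DecidableEq V]

/-- `C`: all four marked vertices lie in ONE component of the spanning subgraph `(V, F)` — verbatim
the predicate of the crux's numerator. Its negation on a `T`-join of `{aᵢ}` is the H-event (the
components of `F` pair the sources 2|2). -/
def JoinsAll (a : Fin 4 → V) (F : Finset (Sym2 V)) : Prop :=
  ∀ i j, (SimpleGraph.fromEdgeSet (↑F : Set (Sym2 V))).Reachable (a i) (a j)

variable (G : SimpleGraph V) [DecidableRel G.Adj]

/-- `P` is a PLAQUETTE of `G`: the edge set of a 4-cycle `w ∼ x ∼ y ∼ z ∼ w` of `G`.  On the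
nearest-neighbour graph of a box of `ℤ³` these are exactly the unit squares inside the box (a closed
4-step lattice walk with distinct vertices spans two distinct axes). -/
def IsPlaquette (P : Finset (Sym2 V)) : Prop :=
  ∃ w x y z : V, w ≠ y ∧ x ≠ z ∧ G.Adj w x ∧ G.Adj x y ∧ G.Adj y z ∧ G.Adj z w ∧
    P = {s(w, x), s(x, y), s(y, z), s(z, w)}

/-- The plaquettes of `G`, as a finset of edge sets. -/
def plaquettes : Finset (Finset (Sym2 V)) :=
  G.edgeFinset.powerset.filter fun P => IsPlaquette G P

/-- NEAR-TOUCH plaquettes of `F` (for `F` an H-configuration): plaquettes EDGE-DISJOINT from `F`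
whose addition joins all four sources — equivalently, with corners on both source clusters of `F`.
The surgery `F ↦ F ⊔ P` (= `F ∆ P`) is the near-touch → touch move of the idea card. -/
def nearTouch (a : Fin 4 → V) (F : Finset (Sym2 V)) : Finset (Finset (Sym2 V)) :=
  (plaquettes G).filter fun P => Disjoint P F ∧ JoinsAll a (F ∪ P)

/-- PIVOTAL plaquettes of `F'` (for `F'` a C-configuration): full plaquettes `P ⊆ F'` whose removal
(= XOR) separates the sources 2|2.  These are exactly the images of the near-touch surgery. -/
def pivotals (a : Fin 4 → V) (F : Finset (Sym2 V)) : Finset (Finset (Sym2 V)) :=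
  (plaquettes G).filter fun P => P ⊆ F ∧ ¬ JoinsAll a (F \ P)

/-- Loop-O(1) mass `Z_t(A; P) = ∑ {t^{|F|} : F ∈ 𝒯_A(G), P F}` of the `T`-joins of
`A = {a₀,…,a₃}` in `G` (`tJoins G univ A`, `Literature/…/LoopO1.lean`) satisfying `P`; the sourced
loop-O(1) probability of `P` is `Z_t(A; P)/Z_t(A; ⊤)`. -/
def zMass (t : ℝ) (a : Fin 4 → V) (P : Finset (Sym2 V) → Prop) : ℝ :=
  ∑ F ∈ (tJoins G Set.univ (univ.image a)).filter (fun F => P F), t ^ #F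

/-- NEAR-TOUCH MASS: total loop-O(1) weight of all near-touch surgeries `F ⊔ P`, `F ∈ H`,
`P ∈ nearTouch F` — i.e. `t⁴ · E_{Z}[#nearTouch ; H]` unnormalised. -/
def ntMass (t : ℝ) (a : Fin 4 → V) : ℝ :=
  ∑ F ∈ (tJoins G Set.univ (univ.image a)).filter (fun F => ¬ JoinsAll a F),
    t ^ (#F + 4) * (#(nearTouch G a F) : ℝ)

/-- PIVOTAL MASS: `E_Z[#pivotals ; C]` unnormalised — loop-O(1) weight of joined configurations
counted with the number of their full pivotal plaquettes. -/
def pivMass (t : ℝ) (a : Fin 4 → V) : ℝ :=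
  ∑ F ∈ (tJoins G Set.univ (univ.image a)).filter (fun F => JoinsAll a F),
    t ^ #F * (#(pivotals G a F) : ℝ)

/-- `Z_t(A; P) ≥ 0` for `t ≥ 0`. -/
theorem zMass_nonneg {t : ℝ} (ht : 0 ≤ t) (a : Fin 4 → V) (P : Finset (Sym2 V) → Prop) :
    0 ≤ zMass G t a P :=
  Finset.sum_nonneg fun _ _ => pow_nonneg ht _

/-- `Z(A) = Z(A; C) + Z(A; H)`. -/
theorem zMass_split (t : ℝ) (a : Fin 4 → V) :
    zMass G t a (fun _ => True) =
      zMass G t a (fun F => JoinsAll a F) + zMass G t a (fun F => ¬ JoinsAll a F) := by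
  unfold zMass
  rw [Finset.sum_filter, Finset.sum_filter, Finset.sum_filter, ← Finset.sum_add_distrib]
  refine Finset.sum_congr rfl fun F _ => ?_
  by_cases h : JoinsAll a F
  · rw [if_pos trivial, if_pos h, if_neg (not_not.mpr h), add_zero]
  · rw [if_pos trivial, if_neg h, if_pos h, zero_add]

/-- Registered stub `stub_massSplit` of the skeleton `Lines/plaquette-xor-surgery.lean` (crux
`ParityRobustMerging`, stmt-CriticalPhenomena-11253): the mass split `Z(A) = Z(A; C) + Z(A; H)` on
every finite graph, for every `t` — `zMass_split` in closed form. -/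
theorem stub_massSplit :
    ∀ (V : Type) [Fintype V] [DecidableEq V] (G : SimpleGraph V) [DecidableRel G.Adj]
      (t : ℝ) (a : Fin 4 → V),
      zMass G t a (fun _ => True) = zMass G t a (fun F => JoinsAll a F) + zMass G t a (fun F => ¬ JoinsAll a F) :=
  fun _ _ _ G _ t a => zMass_split G t a

/-- The total mass `Z_t(A; ⊤)` is the tree's sourced loop-O(1) partition function
`loopO1PartitionFunction G t A` at `A = {aᵢ}` (so `zMass` introduces no new partition function). -/
theorem zMass_true_eq_loopO1PartitionFunction (t : ℝ) (a : Fin 4 → V) :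
    zMass G t a (fun _ => True) = loopO1PartitionFunction G t (univ.image a) := by
  unfold zMass loopO1PartitionFunction loopO1Weight
  rw [← Finset.sum_filter]
  refine Finset.sum_congr ?_ fun _ _ => rfl
  ext F
  simp only [Finset.mem_filter, Finset.mem_powerset]
  constructor
  · rintro ⟨h, -⟩
    exact ⟨((mem_tJoins G).1 h).1, h⟩
  · rintro ⟨-, h⟩
    exact ⟨h, trivial⟩

end General

/-! ### The box setting -/

/-- The nearest-neighbour graph induced on the box `Λ_N ⊂ ℤ³` (verbatim the crux's `let G`). -/
abbrev boxGraph (N : ℕ) : SimpleGraph ↥(box 3 N) := (zdGraph 3).comap Subtype.val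

/-- The critical loop-O(1) edge weight `t_c = tanh β_c(ℤ³)` (`= 0.21810…`). -/
abbrev tc : ℝ := Real.tanh (criticalBeta 3)

end Summit.CriticalPhenomena.Ising3DConformalLimit.Cruxes.ParityRobustMerging.PlaquetteXorSurgery

end
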